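import Literature.Probability.LatticeModels.MarkovWindowDensity
import Literature.Probability.Process.KolmogorovExtensionProofs
import HarnessLib

/-!
# The two-sided stationary Markov chain of a transfer kernel as a measure on `ℤ → S`

Topic `Literature/Probability/LatticeModels`; theorems only (no definitions, no named facts).
Companion of `MarkovWindowDensity.lean`: from the consistent, normalised window densities
`D a n` of a symmetric transfer kernel `k` with pointwise eigenfunction `φ`, eigenvalue `L` and
one-site weight `w` (hypotheses `heig`, `hsym`, `hnorm`, `hD` as there) we build, by the
Kolmogorov extension theorem (tree: `Literature.Probability.Process.exists_isProjectiveLimit_holds`,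
Polish state space), THE law `μ` of the two-sided stationary chain: a probability measure on
`ℤ → S` whose expectation of any observable depending on finitely many coordinates
`{a, …, a+n}` is the marginal integral against the window density,

  `∫ Φ dμ = ∫⋯∫⁻_{a,…,a+n} Φ · D a n`      (`exists_markovChainMeasure`).

This is the measure-theoretic half of the classical construction of one-dimensional Gibbs states
as Markov chains (Georgii 2011, Thm 10.25, §11.1; Spitzer 1971); the DLR property is proved, for
the oscillator chain, in `Literature.MathematicalPhysics.KineticTheory.HeatConduction`.

* `restrict₂_eq_restrict_updateFinset`, `lintegral_map_restrict₂_withDensity` — the window law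
  `(ν^{⊗W} · D) ∘ restrict₂⁻¹` integrates `g` to `∫⋯∫⁻_W (g ∘ restrict) · D`;
* `exists_markovChainMeasure` — **the theorem**.

[cite: Georgii2011, Thm 10.25 and §11.1] [cite: Kallenberg2002, Thm 6.16]
-/

noncomputable section

open MeasureTheory Set Function Finset Literature.Probability.Process
open scoped ENNReal

namespace Literature.Probability.LatticeModels

variable {S : Type*} [MeasurableSpace S] {ν : Measure S}

/-! ### Window laws -/

omit [MeasurableSpace S] in
/-- Restricting a glued window configuration to a sub-window is Mathlib's `restrict₂`. [folklore] -/
theorem restrict₂_eq_restrict_updateFinset {J W : Finset ℤ} (h : J ⊆ W) (η : ℤ → S)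
    (y : ↥W → S) :
    Finset.restrict₂ (π := fun _ : ℤ => S) h y = J.restrict (updateFinset η W y) := by
  funext j
  simp [Finset.restrict₂, updateFinset, h j.2]

/-- `restrict₂` is measurable (coordinatewise). [folklore] -/
theorem measurable_restrict₂' {J W : Finset ℤ} (h : J ⊆ W) :
    Measurable (Finset.restrict₂ (π := fun _ : ℤ => S) h) :=
  measurable_pi_lambda _ fun _ => measurable_pi_apply _

/-- **Integration against a window law.** The measure `(ν^{⊗W} with density D) ∘ restrict₂⁻¹` on
the coordinates `J ⊆ W = {a, …, a+n}` integrates a measurable `g` to the marginal integral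
`(∫⋯∫⁻_W (g ∘ restrict_J) · D)(η)`. [folklore] -/
theorem lintegral_map_restrict₂_withDensity {J : Finset ℤ} {a : ℤ} {n : ℕ}
    (h : J ⊆ Finset.Icc a (a + n)) (η : ℤ → S) {Dan : (ℤ → S) → ℝ≥0∞} (hDm : Measurable Dan)
    {g : (↥J → S) → ℝ≥0∞} (hg : Measurable g) :
    ∫⁻ z : ↥J → S, g z ∂(Measure.map (Finset.restrict₂ (π := fun _ : ℤ => S) h)
        ((Measure.pi fun _ : ↥(Finset.Icc a (a + n)) => ν).withDensity
          (fun y => Dan (updateFinset η (Finset.Icc a (a + n)) y)))) =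
      (∫⋯∫⁻_Finset.Icc a (a + n), (fun σ => g (J.restrict σ) * Dan σ) ∂fun _ : ℤ => ν) η := by
  have hf : Measurable fun y : ↥(Finset.Icc a (a + n)) → S =>
      Dan (updateFinset η (Finset.Icc a (a + n)) y) := hDm.comp measurable_updateFinset
  have hg' : Measurable fun y : ↥(Finset.Icc a (a + n)) → S =>
      g (Finset.restrict₂ (π := fun _ : ℤ => S) h y) := hg.comp (measurable_restrict₂' h)
  rw [lintegral_map hg (measurable_restrict₂' h), lintegral_withDensity_eq_lintegral_mul _ hf hg']
  unfold lmarginal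
  refine lintegral_congr fun y => ?_
  simp only [Pi.mul_apply, restrict₂_eq_restrict_updateFinset h η y, mul_comm]

/-! ### The measure -/

section Measure

variable {k : S → S → ℝ≥0∞} {φ w : S → ℝ≥0∞} {L : ℝ≥0∞} {D : ℤ → ℕ → (ℤ → S) → ℝ≥0∞}

omit [MeasurableSpace S] in
/-- Every site of `J` lies in the centred window `{-N, …, N}`, `N = max_{j ∈ J} |j|`, written in
the form `{a, …, a + n}` with `a = -N`, `n = 2N`. [folklore] -/
theorem subset_Icc_sup_natAbs (J : Finset ℤ) :
    J ⊆ Finset.Icc (-((J.sup Int.natAbs : ℕ) : ℤ))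
      (-((J.sup Int.natAbs : ℕ) : ℤ) + ↑(2 * J.sup Int.natAbs)) := by
  intro j hj
  have h : j.natAbs ≤ J.sup Int.natAbs := Finset.le_sup (f := Int.natAbs) hj
  simp only [Finset.mem_Icc]
  push_cast
  omega

/-- **The two-sided stationary Markov chain of a transfer kernel exists as a measure on `ℤ → S`.**
Let `S` be Polish with its Borel σ-algebra and `ν` a σ-finite a priori measure; let `k`, `φ`, `w`,
`L` satisfy the pointwise eigen-equation `∫ k(z,y) φ(y) w(y) dν(y) = L φ(z)`, symmetry of `k` and
`∫ φ² w dν = 1`, and let `D a n` be the window densities of `MarkovWindowDensity`. Then there is a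
probability measure `μ` on `ℤ → S` such that for every window `{a, …, a+n}` and every measurable
`Φ ≥ 0` depending only on the coordinates in it, `∫ Φ dμ = (∫⋯∫⁻_{a,…,a+n} Φ · D a n)(η)` (any
`η`). Proof: the window laws form a projective family by `lmarginal_window_reduction`; Kolmogorov
extension. [cite: Georgii2011, Thm 10.25 and §11.1] -/
theorem exists_markovChainMeasure [TopologicalSpace S] [PolishSpace S] [BorelSpace S]
    [Nonempty S] [SigmaFinite ν]
    (hk : Measurable (uncurry k)) (hφ : Measurable φ) (hw : Measurable w)
    (hL0 : L ≠ 0) (hLt : L ≠ ∞)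
    (heig : ∀ z, ∫⁻ y, k z y * φ y * w y ∂ν = L * φ z) (hsym : ∀ z y, k z y = k y z)
    (hnorm : ∫⁻ y, φ y ^ 2 * w y ∂ν = 1)
    (hD : ∀ a n σ, D a n σ = φ (σ a) * φ (σ (a + n)) *
      (∏ j ∈ Finset.range n, k (σ (a + j)) (σ (a + j + 1)) * L⁻¹) *
      ∏ j ∈ Finset.range (n + 1), w (σ (a + j))) :
    ∃ μ : Measure (ℤ → S), IsProbabilityMeasure μ ∧
      ∀ (a : ℤ) (n : ℕ) (Φ : (ℤ → S) → ℝ≥0∞), Measurable Φ →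
        DependsOn Φ (↑(Finset.Icc a (a + n)) : Set ℤ) → ∀ η : ℤ → S,
          ∫⁻ σ, Φ σ ∂μ =
            (∫⋯∫⁻_Finset.Icc a (a + n), (fun σ => Φ σ * D a n σ) ∂fun _ : ℤ => ν) η := by
  classical
  set η₀ : ℤ → S := fun _ => Classical.arbitrary S with hη₀
  -- the centred window `{-N J, …, N J}` containing `J`, in the form `{a, …, a + n}`
  obtain ⟨N, hN⟩ : ∃ N : Finset ℤ → ℕ, ∀ J, N J = J.sup Int.natAbs := ⟨_, fun _ => rfl⟩
  have hJW : ∀ J : Finset ℤ, J ⊆ Finset.Icc (-(N J : ℤ)) (-(N J : ℤ) + ↑(2 * N J)) := fun J => by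
    rw [hN]; exact subset_Icc_sup_natAbs J
  have hNmono : ∀ {I J : Finset ℤ}, J ⊆ I → N J ≤ N I := fun h => by
    rw [hN, hN]; exact Finset.sup_mono h
  -- the window laws, and their push-forwards to arbitrary finite `J`
  obtain ⟨Q, hQ⟩ : ∃ Q : ∀ (a : ℤ) (n : ℕ), Measure (↥(Finset.Icc a (a + n)) → S),
      ∀ a n, Q a n = (Measure.pi fun _ => ν).withDensity
        (fun y => D a n (updateFinset η₀ (Finset.Icc a (a + n)) y)) := ⟨_, fun _ _ => rfl⟩
  obtain ⟨P, hP⟩ : ∃ P : ∀ J : Finset ℤ, Measure (↥J → S), ∀ J, P J =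
      Measure.map (Finset.restrict₂ (π := fun _ : ℤ => S) (hJW J)) (Q (-(N J : ℤ)) (2 * N J)) :=
    ⟨_, fun _ => rfl⟩
  -- integration against `P J` is a marginal integral over the window `W_J`
  have hPint : ∀ (J : Finset ℤ) {g : (↥J → S) → ℝ≥0∞}, Measurable g →
      ∫⁻ z, g z ∂(P J) = (∫⋯∫⁻_Finset.Icc (-(N J : ℤ)) (-(N J : ℤ) + ↑(2 * N J)),
        (fun σ => g (J.restrict σ) * D (-(N J : ℤ)) (2 * N J) σ) ∂fun _ : ℤ => ν) η₀ := by
    intro J g hg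
    rw [hP J, hQ, lintegral_map_restrict₂_withDensity (hJW J) η₀ (measurable_D hk hφ hw hD _ _) hg]
  -- observables factoring through the restriction to `J` depend only on `J`
  have hdepJ : ∀ (J : Finset ℤ) (g : (↥J → S) → ℝ≥0∞) {a : ℤ} {n : ℕ}, J ⊆ Finset.Icc a (a + n) →
      DependsOn (fun σ : ℤ → S => g (J.restrict σ)) (↑(Finset.Icc a (a + n)) : Set ℤ) := by
    intro J g a n hJ x y hxy
    dsimp only
    congr 1
    funext j
    exact hxy j (Finset.mem_coe.2 (hJ j.2))
  have hmeasJ : ∀ (J : Finset ℤ) {g : (↥J → S) → ℝ≥0∞}, Measurable g →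
      Measurable fun σ : ℤ → S => g (J.restrict σ) := fun J g hg =>
    hg.comp (Finset.measurable_restrict J)
  -- projectivity
  have hproj : IsProjectiveMeasureFamily (α := fun _ : ℤ => S) P := by
    intro I J hJI
    have hNle : N J ≤ N I := hNmono hJI
    refine Measure.ext_of_lintegral _ fun g hg => ?_
    have hgr : Measurable fun z : ↥I → S => g (Finset.restrict₂ (π := fun _ : ℤ => S) hJI z) :=
      hg.comp (measurable_restrict₂' hJI)
    rw [lintegral_map hg (measurable_restrict₂' hJI), hPint J hg, hPint I hgr]
    -- `restrict₂ hJI ∘ restrict_I = restrict_J`, then reduce the window `W_I` to `W_J`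
    change _ = (∫⋯∫⁻_Finset.Icc (-(N I : ℤ)) (-(N I : ℤ) + ↑(2 * N I)),
        (fun σ => g (J.restrict σ) * D (-(N I : ℤ)) (2 * N I) σ) ∂fun _ : ℤ => ν) η₀
    symm
    exact congrFun (lmarginal_window_reduction hk hφ hw hL0 hLt heig hsym hD
      (by omega) (by push_cast; omega) (hmeasJ J hg) (hdepJ J g (hJW J))) η₀
  -- probability
  have hprob : ∀ J, IsProbabilityMeasure (P J) := by
    intro J
    have h1 : ∫⁻ _, (1 : ℝ≥0∞) ∂(P J) = 1 := by
      rw [hPint J measurable_const]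
      simp only [one_mul]
      exact lmarginal_D_eq_one hk hφ hw hL0 hLt heig hsym hnorm hD _ _ η₀
    rw [lintegral_one] at h1
    exact ⟨h1⟩
  -- Kolmogorov extension
  obtain ⟨μ, hμ⟩ : ∃ μ : Measure (ℤ → S), IsProjectiveLimit (α := fun _ : ℤ => S) μ P :=
    exists_isProjectiveLimit_holds (ι := ℤ) (α := fun _ : ℤ => S) hproj
  haveI : IsProbabilityMeasure μ := hμ.isProbabilityMeasure
  refine ⟨μ, inferInstance, fun a n Φ hΦm hΦd η => ?_⟩
  -- factor `Φ` through the restriction to `J = {a, …, a+n}`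
  set J : Finset ℤ := Finset.Icc a (a + n) with hJ
  obtain ⟨g, hg⟩ : ∃ g : (↥J → S) → ℝ≥0∞, ∀ y, g y = Φ (updateFinset η₀ J y) := ⟨_, fun _ => rfl⟩
  have hgm : Measurable g := by
    rw [show g = fun y => Φ (updateFinset η₀ J y) from funext hg]
    exact hΦm.comp measurable_updateFinset
  have hfac : ∀ σ, Φ σ = g (J.restrict σ) := fun σ => by
    rw [hg]
    exact hΦd fun i hi => by simp [updateFinset, Finset.mem_coe.1 hi]
  have h1 : ∫⁻ σ, Φ σ ∂μ = ∫⁻ z, g z ∂(P J) := by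
    rw [← hμ J, lintegral_map hgm (Finset.measurable_restrict J)]
    exact lintegral_congr fun σ => by rw [hfac σ]
  have hwin : J ⊆ Finset.Icc (-(N J : ℤ)) (-(N J : ℤ) + ↑(2 * N J)) := hJW J
  have ha : -(N J : ℤ) ≤ a := by
    have := hwin (Finset.mem_Icc.2 ⟨le_rfl, by omega⟩ : a ∈ J)
    simp only [Finset.mem_Icc] at this; exact this.1
  have hb : a + n ≤ -(N J : ℤ) + ↑(2 * N J) := by
    have := hwin (Finset.mem_Icc.2 ⟨by omega, le_rfl⟩ : a + (n : ℤ) ∈ J)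
    simp only [Finset.mem_Icc] at this; exact this.2
  rw [h1, hPint J hgm,
    congrFun (lmarginal_window_reduction hk hφ hw hL0 hLt heig hsym hD ha hb (hmeasJ J hgm)
      (hdepJ J g (subset_refl _))) η₀,
    lmarginal_eq_of_dependsOn (ν := ν) ?_ η₀ η]
  · rw [show (fun σ => g (J.restrict σ) * D a n σ) = fun σ => Φ σ * D a n σ from
      funext fun σ => by rw [← hfac σ]]
  · intro x y hxy
    dsimp only
    rw [← hfac x, ← hfac y, hΦd hxy, dependsOn_D hD a n hxy]

end Measure

end Literature.Probability.LatticeModels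

end
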